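import Summits.AnomalousDissipation.AnomalousDissipation.Theorems.KolmogorovFloor.Negative.TwoModes

/-!
# A resolved base mode dressed with two unresolved waves (negative side of `KolmogorovFloor`, stmt-14030)

cdisprove seat `refuter-cdisprove-stmt-AnomalousDissipation-14030-0` (2026-08-16). Fourier bookkeeping of
the three-mode state `Re(e_{k₀} ⊗ z₀) + Re(e_p ⊗ z_A) + Re(e_{p+q} ⊗ z_B)` — a LAMINAR RAY `Re(e_{k₀} ⊗ z₀)` (a
single transversal Fourier mode: a steady Euler flow, so its own inertial term vanishes) carrying two waves
above the resolution: the waves are invisible to the coordinates (`coords_three_base_eq`: the multiplier is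
that of the bare laminar state), to the Laplacian pairing (`laplacian_three_base`: only the base mode drifts),
and the inertial term is the single beat at `q` (`inertial_three_base`); `pairing_three_base` splits the
injection. The landed `inertial_three` (`Negative/ModesFourier.lean`) is the special case `k₀ = e₂`. Used by the
energy-channel analysis of the crux (`Negative/WeightsVanish.lean`). Toolkit: `Theorems/TaylorCertificatePair/Negative/*`.
-/

noncomputable section

open MeasureTheory UnitAddTorus Matrix
open scoped InnerProductSpace ENNReal ComplexConjugate

namespace Summit.AnomalousDissipation.AnomalousDissipation.Theorems.KolmogorovFloor.Negative

open Literature.Analysis.FunctionSpaces Literature.Analysis.FluidPDE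
open Summit.AnomalousDissipation.AnomalousDissipation.Theorems.TaylorCertificatePair.Negative

/-- Membership facts for the three-mode frequency vector with a general base. -/
theorem three_base_ne_zero {k₀ p q : Fin 3 → ℤ} (hk : k₀ ≠ 0) (hp : p ≠ 0) (hpq : p + q ≠ 0) :
    ∀ m, (![k₀, p, p + q] : Fin 3 → (Fin 3 → ℤ)) m ≠ 0 := by
  intro m
  fin_cases m
  · exact hk
  · exact hp
  · exact hpq

/-- Transversality of the three polarisations. -/
theorem three_base_dotc {k₀ p q : Fin 3 → ℤ} {z₀ zA zB : (EuclideanSpace ℂ (Fin 3))}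
    (h0 : ((fun j => ((k₀) j : ℂ)) ⬝ᵥ (WithLp.ofLp (z₀))) = 0)
    (hA : ((fun j => ((p) j : ℂ)) ⬝ᵥ (WithLp.ofLp (zA))) = 0)
    (hB : ((fun j => (((p + q)) j : ℂ)) ⬝ᵥ (WithLp.ofLp (zB))) = 0) :
    ∀ m, ((fun j => ((((![k₀, p, p + q] : Fin 3 → (Fin 3 → ℤ)) m)) j : ℂ)) ⬝ᵥ (WithLp.ofLp (((![z₀, zA, zB] : Fin 3 → (EuclideanSpace ℂ (Fin 3))) m)))) = 0 := by
  intro m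
  fin_cases m
  · exact h0
  · exact hA
  · exact hB

/-- Frequencies of the three-mode state are bounded by `L` once `|k₀|², |p|², |p+q|² ≤ L²`. -/
theorem three_base_freq_le {k₀ p q : Fin 3 → ℤ} {L : ℕ} (hk : Torus.freqNormSq k₀ ≤ (L : ℝ) ^ 2)
    (hLp : Torus.freqNormSq p ≤ (L : ℝ) ^ 2) (hLpq : Torus.freqNormSq (p + q) ≤ (L : ℝ) ^ 2) :
    ∀ m, Torus.freqNormSq ((![k₀, p, p + q] : Fin 3 → (Fin 3 → ℤ)) m) ≤ (L : ℝ) ^ 2 := by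
  intro m
  fin_cases m
  · exact hk
  · exact hLp
  · exact hLpq

/-- **The beat over a laminar base.** Inertial term of base mode `k₀` + two unresolved modes `p`, `p + q`
against a smooth band-limited `G`: the base mode's self-interaction vanishes identically (a single transversal
mode is a steady Euler flow), the base–wave interactions fall outside the ball, and only the `(p, p+q)` beat at
`q` survives. -/
theorem inertial_three_base {G : (UnitAddTorus (Fin 3)) → (EuclideanSpace ℝ (Fin 3))} (hG : Torus.IsSmooth G) (k₀ p q : Fin 3 → ℤ) (z₀ zA zB : (EuclideanSpace ℂ (Fin 3)))
    (hs : ((fun j => ((k₀) j : ℂ)) ⬝ᵥ (WithLp.ofLp (z₀))) = 0) (hA : ((fun j => ((p) j : ℂ)) ⬝ᵥ (WithLp.ofLp (zA))) = 0) (hB : ((fun j => (((p + q)) j : ℂ)) ⬝ᵥ (WithLp.ofLp (zB))) = 0)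
    (hBq : ((fun j => ((q) j : ℂ)) ⬝ᵥ (WithLp.ofLp (zB))) = 0)
    (h1 : (mFourierCoeff (EuclideanSpace.complexify ∘ G) (k₀ + p)) = 0) (h2 : (mFourierCoeff (EuclideanSpace.complexify ∘ G) (p - k₀)) = 0) (h3 : (mFourierCoeff (EuclideanSpace.complexify ∘ G) (p + k₀)) = 0)
    (h4 : (mFourierCoeff (EuclideanSpace.complexify ∘ G) (k₀ - p)) = 0) (h5 : (mFourierCoeff (EuclideanSpace.complexify ∘ G) (k₀ + (p + q))) = 0) (h6 : (mFourierCoeff (EuclideanSpace.complexify ∘ G) ((p + q) - k₀)) = 0)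
    (h7 : (mFourierCoeff (EuclideanSpace.complexify ∘ G) ((p + q) + k₀)) = 0) (h8 : (mFourierCoeff (EuclideanSpace.complexify ∘ G) (k₀ - (p + q))) = 0)
    (h9 : (mFourierCoeff (EuclideanSpace.complexify ∘ G) (p + (p + q))) = 0) (h10 : (mFourierCoeff (EuclideanSpace.complexify ∘ G) ((p + q) + p)) = 0) :
    ∫ x, ⟪Torus.fderiv G x ((∑ mm, Torus.realTrigPoly {![k₀, p, p + q] mm} (fun _ => ![z₀, zA, zB] mm)) x),
        (∑ mm, Torus.realTrigPoly {![k₀, p, p + q] mm} (fun _ => ![z₀, zA, zB] mm)) x⟫_ℝ =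
      Real.pi * (conj (((fun j => ((q) j : ℂ)) ⬝ᵥ (WithLp.ofLp (zA)))) * ⟪(mFourierCoeff (EuclideanSpace.complexify ∘ G) q), zB⟫_ℂ).im := by
  rw [inertial_modes hG]
  have e1 : p + q - p = q := add_sub_cancel_left p q
  have e2' : p - (p + q) = -q := by abel
  have d00 : ((fun j => (((k₀ + k₀)) j : ℂ)) ⬝ᵥ (WithLp.ofLp (z₀))) = 0 := by rw [dotc_add_left, hs, add_zero]
  have d11 : ((fun j => (((p + p)) j : ℂ)) ⬝ᵥ (WithLp.ofLp (zA))) = 0 := by rw [dotc_add_left, hA, add_zero]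
  have d22 : ((fun j => (((p + q + (p + q))) j : ℂ)) ⬝ᵥ (WithLp.ofLp (zB))) = 0 := by rw [dotc_add_left, hB, add_zero]
  have hA2 : ((fun j => (((p + q - p)) j : ℂ)) ⬝ᵥ (WithLp.ofLp (zA))) = ((fun j => ((q) j : ℂ)) ⬝ᵥ (WithLp.ofLp (zA))) := by rw [e1]
  have hBm : ((fun j => (((-q)) j : ℂ)) ⬝ᵥ (WithLp.ofLp (zB))) = 0 := by rw [dotc_neg_left, hBq, neg_zero]
  simp only [Fin.sum_univ_three, Matrix.cons_val_zero, Matrix.cons_val_one, Matrix.cons_val_two,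
    Matrix.head_cons, Matrix.tail_cons, sub_self, dotc_zero_left, d00, d11, d22, hA2, e2', hBm,
    h1, h2, h3, h4, h5, h6, h7, h8, h9, h10, zero_mul, mul_zero, map_zero,
    inner_zero_left, Complex.zero_im, add_zero, zero_add]
  rw [e1]

/-- The Laplacian pairing of the dressed laminar state: only the (resolved) base mode drifts. -/
theorem laplacian_three_base {G : (UnitAddTorus (Fin 3)) → (EuclideanSpace ℝ (Fin 3))} (hG : Torus.IsSmooth G)
    (k₀ : Fin 3 → ℤ) (z₀ zA zB : (EuclideanSpace ℂ (Fin 3))) {p q : Fin 3 → ℤ} (hp : (mFourierCoeff (EuclideanSpace.complexify ∘ G) p) = 0) (hpq : (mFourierCoeff (EuclideanSpace.complexify ∘ G) (p + q)) = 0) :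
    ∫ x, ⟪(∑ mm, Torus.realTrigPoly {![k₀, p, p + q] mm} (fun _ => ![z₀, zA, zB] mm)) x, Torus.laplacian G x⟫_ℝ =
      (⟪z₀, -(((4 * Real.pi ^ 2 * Torus.freqNormSq k₀ : ℝ) : ℂ) • (mFourierCoeff (EuclideanSpace.complexify ∘ G) k₀))⟫_ℂ).re := by
  rw [integral_inner_modes_laplacian hG]
  simp only [Fin.sum_univ_three, Matrix.cons_val_zero, Matrix.cons_val_one, Matrix.cons_val_two,
    Matrix.head_cons, Matrix.tail_cons, hp, hpq, smul_zero, neg_zero, inner_zero_right, Complex.zero_re, add_zero]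

/-- The drift of the base mode is bounded by its amplitude and the resolved coefficient of the multiplier. -/
theorem laplacian_base_le (k₀ : Fin 3 → ℤ) (z₀ g : (EuclideanSpace ℂ (Fin 3))) :
    |(⟪z₀, -(((4 * Real.pi ^ 2 * Torus.freqNormSq k₀ : ℝ) : ℂ) • g)⟫_ℂ).re| ≤
      4 * Real.pi ^ 2 * Torus.freqNormSq k₀ * ‖z₀‖ * ‖g‖ := by
  refine (abs_re_inner_le_norm_mul _ _).trans ?_
  have h4 : (0 : ℝ) ≤ 4 * Real.pi ^ 2 * Torus.freqNormSq k₀ := by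
    have := Torus.freqNormSq_nonneg k₀; positivity
  rw [norm_neg, norm_smul, Complex.norm_real, Real.norm_of_nonneg h4]
  nlinarith [norm_nonneg z₀, norm_nonneg g]

/-- The injection of the dressed laminar state splits into base and waves. -/
theorem pairing_three_base {f : (UnitAddTorus (Fin 3)) → (EuclideanSpace ℝ (Fin 3))} (hf : Integrable f volume)
    (k₀ : Fin 3 → ℤ) (z₀ zA zB : (EuclideanSpace ℂ (Fin 3))) (p q : Fin 3 → ℤ) :
    ∫ x, ⟪(∑ mm, Torus.realTrigPoly {![k₀, p, p + q] mm} (fun _ => ![z₀, zA, zB] mm)) x, f x⟫_ℝ =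
      (⟪z₀, (mFourierCoeff (EuclideanSpace.complexify ∘ f) k₀)⟫_ℂ).re +
        ((⟪zA, (mFourierCoeff (EuclideanSpace.complexify ∘ f) p)⟫_ℂ).re + (⟪zB, (mFourierCoeff (EuclideanSpace.complexify ∘ f) (p + q))⟫_ℂ).re) := by
  rw [integral_inner_modes_left hf]
  simp only [Fin.sum_univ_three, Matrix.cons_val_zero, Matrix.cons_val_one, Matrix.cons_val_two,
    Matrix.head_cons, Matrix.tail_cons]
  ring

/-- Negating the wave polarisations negates the wave part of the injection and keeps the base part. -/
theorem pairing_three_base_neg {f : (UnitAddTorus (Fin 3)) → (EuclideanSpace ℝ (Fin 3))} (hf : Integrable f volume)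
    (k₀ : Fin 3 → ℤ) (z₀ zA zB : (EuclideanSpace ℂ (Fin 3))) (p q : Fin 3 → ℤ) :
    ∫ x, ⟪(∑ mm, Torus.realTrigPoly {![k₀, p, p + q] mm} (fun _ => ![z₀, -zA, -zB] mm)) x, f x⟫_ℝ =
      (⟪z₀, (mFourierCoeff (EuclideanSpace.complexify ∘ f) k₀)⟫_ℂ).re -
        ((⟪zA, (mFourierCoeff (EuclideanSpace.complexify ∘ f) p)⟫_ℂ).re + (⟪zB, (mFourierCoeff (EuclideanSpace.complexify ∘ f) (p + q))⟫_ℂ).re) := by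
  rw [pairing_three_base hf, inner_neg_left, inner_neg_left, Complex.neg_re, Complex.neg_re]
  ring

/-- The coordinates of the dressed laminar state are those of the bare laminar state: the waves are invisible. -/
theorem coords_three_base_eq (Φ : Torus.CylindricalTest (Fin 3)) {N : ℕ}
    (hΦ : ∀ i, Torus.fourierTruncate N (Φ.g i) = Φ.g i) {k₀ p q : Fin 3 → ℤ} {z₀ zA zB : (EuclideanSpace ℂ (Fin 3))}
    (hNp : (N : ℝ) ^ 2 < Torus.freqNormSq p) (hNpq : (N : ℝ) ^ 2 < Torus.freqNormSq (p + q))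
    {uw ub : (Torus.energySpace (Fin 3))}
    (huw : (((uw : (Torus.energySpace (Fin 3))) : (Lp (EuclideanSpace ℝ (Fin 3)) 2 (volume : Measure (UnitAddTorus (Fin 3))))) : (UnitAddTorus (Fin 3)) → (EuclideanSpace ℝ (Fin 3))) =ᵐ[volume] (∑ mm, Torus.realTrigPoly {![k₀, p, p + q] mm} (fun _ => ![z₀, zA, zB] mm)))
    (hub : (((ub : (Torus.energySpace (Fin 3))) : (Lp (EuclideanSpace ℝ (Fin 3)) 2 (volume : Measure (UnitAddTorus (Fin 3))))) : (UnitAddTorus (Fin 3)) → (EuclideanSpace ℝ (Fin 3))) =ᵐ[volume] (∑ mm, Torus.realTrigPoly {![k₀] mm} (fun _ => ![z₀] mm))) :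
    Φ.coords uw = Φ.coords ub := by
  ext i
  rw [coords_of_ae huw, coords_of_ae hub, integral_inner_modes_left (Φ.g_smooth i).integrable,
    integral_inner_modes_left (Φ.g_smooth i).integrable]
  simp only [Fin.sum_univ_three, Fin.sum_univ_one, Matrix.cons_val_zero, Matrix.cons_val_one,
    Matrix.cons_val_two, Matrix.head_cons, Matrix.tail_cons, Matrix.cons_val_fin_one]
  rw [fc_g_eq_zero Φ hΦ i p hNp, fc_g_eq_zero Φ hΦ i (p + q) hNpq, inner_zero_right, inner_zero_right,
    Complex.zero_re, add_zero, add_zero]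

end Summit.AnomalousDissipation.AnomalousDissipation.Theorems.KolmogorovFloor.Negative
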